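import Mathlib.Data.Real.Basic
import Mathlib.Algebra.Order.Field.Basic
import Mathlib.Tactic.Linarith
import Mathlib.Tactic.Positivity
import Mathlib.Tactic.Ring
import HarnessLib

/-!
# `NoHeavyLowerTail` (stmt-CriticalPhenomena-4575) — the reduction "(L_β) at every state ⟹ the layer cake (LC-F)" as a finite-tree theorem

Support file (prover prim-ineq-gen-8 gen 47; `--supports stmt-CriticalPhenomena-4575`; memo
run/shared/lean/prim/prim-ineq-gen-8/FINDING-gen47-POTENTIAL.md §6(b)).  A bookkeeping tree type and one induction: no named facts, no sorries.

SETTING.  Along the (boundary-largest-m̂-first) exploration of the apex cluster, a state `s` queries an edge of weight `p_s`; it carries the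
squared expected piece load `A_s = a_s²`, the diagonal term `c_s`, the budget `F_s = Σ_z ℓ_z Var_s(1[z∈K])`, the variance `V_s = Var_s(L)`, a
CERTIFIED lower bound `B_s` for the big-piece variance of its subtree (`…APLVwCoreCertificate.lean`), and the flag `small_s` (`b_s ≤ m a_s`).  The
martingale identities give `F_s = p q c_s + p F_{s¹} + q F_{s⁰}` and `V_s = p q A_s + p V_{s¹} + q V_{s⁰}`; the small-piece variance is
`X_s = p q A_s·1[small_s] + p X_{s¹} + q X_{s⁰}` and the certificate says `X_s ≤ V_s − B_s` (i.e. `X_big ≥ B`).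

THIS FILE proves [this work]: `LTree.small_le_budget` — if at every SMALL node the local inequality
  **(L_B) `p q (A − m c) ≤ p (m F¹ − V¹ + B¹)⁺ + q (m F⁰ − V⁰ + B⁰)⁺`**
holds (children data), then `X_root ≤ m F_root`, i.e. (LC-F) for the tree (memo §6(b): "the six-line step"; with the probabilistic identifications this is
(LC-F) ⟹ (V-F) ⟹ (V) ⟹ (Q0) ⟹ `E3(θ) ≤ 0`, conditional only on (L_B) for the core certificate `B = β′`).
-/

noncomputable section

namespace Summit.CriticalPhenomena.PercolationContinuityZ3.Theorems

namespace APL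

/-- Bookkeeping tree for the layer-cake induction: a leaf (cluster determined) or a node querying an edge of weight `p` with data
`A = a²`, `c`, budget `F`, variance `V`, certified big variance `B`, smallness flag, and the two subtrees (edge open / closed). [this work] -/
inductive LTree : Type
  | leaf : LTree
  | node (p A c F V B : ℝ) (small : Bool) (l r : LTree) : LTree

namespace LTree

/-- budget `F` of the (sub)tree root (0 at a leaf). -/
def F : LTree → ℝ
  | leaf => 0
  | node _ _ _ F _ _ _ _ _ => F
/-- variance `V` of the (sub)tree root (0 at a leaf). -/
def V : LTree → ℝ
  | leaf => 0
  | node _ _ _ _ V _ _ _ _ => V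
/-- certified big variance `B` of the (sub)tree root (0 at a leaf). -/
def B : LTree → ℝ
  | leaf => 0
  | node _ _ _ _ _ B _ _ _ => B
/-- small-piece variance `X = Σ_{small s} w_s p_s q_s a_s²` of the (sub)tree. -/
def X : LTree → ℝ
  | leaf => 0
  | node p A _ _ _ _ small l r => (if small then p * (1 - p) * A else 0) + p * l.X + (1 - p) * r.X

/-- Well-formedness + hypotheses at every node: `p ∈ [0,1]`, `A, c ≥ 0`, the two martingale identities for `F` and `V`, the certificate
`X ≤ V − B`, and — at small nodes — the local inequality (L_B) for the threshold `m`. [this work] -/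
def good (m : ℝ) : LTree → Prop
  | leaf => True
  | node p A c F V B small l r =>
      0 ≤ p ∧ p ≤ 1 ∧ 0 ≤ A ∧ 0 ≤ c ∧
      F = p * (1 - p) * c + p * l.F + (1 - p) * r.F ∧
      V = p * (1 - p) * A + p * l.V + (1 - p) * r.V ∧
      (node p A c F V B small l r).X ≤ V - B ∧
      (small = true → p * (1 - p) * (A - m * c) ≤ p * max (m * l.F - l.V + l.B) 0 + (1 - p) * max (m * r.F - r.V + r.B) 0) ∧
      l.good m ∧ r.good m

/-- The certificate hypothesis read off at the root of a good tree. -/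
theorem X_le_V_sub_B (m : ℝ) : ∀ t : LTree, t.good m → t.X ≤ t.V - t.B
  | leaf, _ => by simp [LTree.X, LTree.V, LTree.B]
  | node p A c FF VV BB small l r, h => by
      rcases h with ⟨_, _, _, _, _, _, hcert, _, _, _⟩
      show (node p A c FF VV BB small l r).X ≤ VV - BB
      exact hcert

/-- **(L_B) at every small node ⟹ (LC-F) for the tree**: `X_root ≤ m F_root` (for `m ≥ 0`).  Induction: a big node is free (`F ≥ p F¹ + q F⁰`);
at a small node `X = pqA + pX¹ + qX⁰` with `Xⁱ ≤ m Fⁱ` (induction) and `Xⁱ ≤ Vⁱ − Bⁱ` (certificate), so `Xⁱ ≤ m Fⁱ − (m Fⁱ − Vⁱ + Bⁱ)⁺`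
and (L_B) closes. [this work] -/
theorem small_le_budget (m : ℝ) (hm : 0 ≤ m) : ∀ t : LTree, t.good m → t.X ≤ m * t.F
  | leaf, _ => by simp [LTree.X, LTree.F]
  | node p A c FF VV BB small l r, h => by
      rcases h with ⟨hp0, hp1, hA, hc, hF, hV, hcert, hL, hl, hr⟩
      have ihl := small_le_budget m hm l hl
      have ihr := small_le_budget m hm r hr
      have cl := X_le_V_sub_B m l hl
      have cr := X_le_V_sub_B m r hr
      have hq : 0 ≤ 1 - p := by linarith
      -- Xⁱ ≤ m Fⁱ − (m Fⁱ − Vⁱ + Bⁱ)⁺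
      have kl : l.X ≤ m * l.F - max (m * l.F - l.V + l.B) 0 := by
        rcases le_total (m * l.F - l.V + l.B) 0 with h | h
        · rw [max_eq_right h]; linarith
        · rw [max_eq_left h]; linarith
      have kr : r.X ≤ m * r.F - max (m * r.F - r.V + r.B) 0 := by
        rcases le_total (m * r.F - r.V + r.B) 0 with h | h
        · rw [max_eq_right h]; linarith
        · rw [max_eq_left h]; linarith
      have e1 : p * l.X ≤ p * (m * l.F - max (m * l.F - l.V + l.B) 0) := mul_le_mul_of_nonneg_left kl hp0
      have e0 : (1 - p) * r.X ≤ (1 - p) * (m * r.F - max (m * r.F - r.V + r.B) 0) := mul_le_mul_of_nonneg_left kr hq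
      have hm1 : 0 ≤ max (m * l.F - l.V + l.B) 0 := le_max_right _ _
      have hm0 : 0 ≤ max (m * r.F - r.V + r.B) 0 := le_max_right _ _
      have hpqc : 0 ≤ m * (p * (1 - p) * c) := by positivity
      show (node p A c FF VV BB small l r).X ≤ m * FF
      cases small with
      | false =>
          have hX : (node p A c FF VV BB false l r).X = p * l.X + (1 - p) * r.X := by
            simp [LTree.X]
          rw [hX, hF]
          have f1 : p * l.X ≤ p * (m * l.F) := mul_le_mul_of_nonneg_left ihl hp0
          have f0 : (1 - p) * r.X ≤ (1 - p) * (m * r.F) := mul_le_mul_of_nonneg_left ihr hq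
          nlinarith [f1, f0, hpqc]
      | true =>
          have hX : (node p A c FF VV BB true l r).X = p * (1 - p) * A + p * l.X + (1 - p) * r.X := by
            simp [LTree.X]
          rw [hX, hF]
          have hLB := hL rfl
          nlinarith [e1, e0, hLB, hm1, hm0, hp0, hq]

end LTree

end APL

end Summit.CriticalPhenomena.PercolationContinuityZ3.Theorems

end
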